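import Mathlib
import Summits.ResolutionOfSingularities.ResolutionOfSingularities.Theorems.WeightedInvariantLocalWeightedDropNCResSurfGraphCurveCentre
import Summits.ResolutionOfSingularities.ResolutionOfSingularities.Theorems.WeightedInvariantLocalWeightedDropTOT2E1Presentation

/-!
# `WeightedInvariant.LocalWeightedDrop`: NC-resolution settings for the TOT₂ line — GRAPH SURFACES, part 10: (P1) FOR THE CURVE MOVE ALONG
# `Γ_a = S ∩ E_a` (the partial shear straightening the surface off the boundary makes `Γ_a` a permissible coordinate centre)

Crux item stmt-ResolutionOfSingularities-8899 `LocalWeightedDrop` (route `ResolutionOfSingularities/WeightedInvariant`), ENGINE skeleton v32/v33, residuals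
`stub_spaceNCRankDrop` / `stub_wildWideApexFourStartsWon` (res-L1-w43-strat-1's line `directrix-cut` v3.1, piece PL = `ApexPlaneExit`, SURFACE sub-case;
design memo `L/res-L1-w43-stub-4/g5/S-E2-SURF.md` §6).  [OURS · L1 W4.3 · chain w43 · seat res-L1-w43-stub-4 gen 5; def-free on parts 1, 2, 9; the count
game is the programme's own; nothing here is a statement of any manuscript; AI-produced, gate-checked, weaker than expert review.]

* `X_dvd_onPlane_of_X_zero_dvd` — bookkeeping;
* **`le_weightedOrder_partialShear`** — for a graph surface `(a, b, ψ)` permissible at order `c` for `g` and a letter set `E` whose off-base members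
  have traces divisible by `u₁` (`Γ_a ⊂ E_l`): the PARTIAL shear `Φ̂ = shear_{a,b}(ψ̂)` (`ψ̂ = 0` on `E`, `ψ` elsewhere; legal, letter-preserving on
  `E`, so (P3) is free) has `c ≤ weightedOrder_{𝟙_{≠ b}} (Φ̂^* g)`: its coordinate centre `V(x_i : i ≠ b)`, whose image is `Γ_a`, is permissible for
  `g` — the input of S-SET's `isBPermissible_of_totalO_weightedOrder` for the curve move of memo §6.  Proof: `Φ̂ = Φ ∘ τ`, `τ_l = x_l − ψ_l(x_a, x_b)`
  on the off-base letters of `E` (identity elsewhere), and part 9's transport.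
-/

set_option linter.dupNamespace false -- mandated namespace of this single-conjunct summit

noncomputable section

namespace Summit.ResolutionOfSingularities.ResolutionOfSingularities.Theorems

namespace TameFourTupleDrop

namespace GraphSurf

open MvPowerSeries Literature.AlgebraicGeometry.Resolution

variable {k : Type} [Field k] {m : ℕ}

/-- `x_a ∣ ψ(x_a, x_b)` when `u₁ ∣ ψ`. -/
theorem X_dvd_onPlane_of_X_zero_dvd (a b : Fin (m + 1)) {ψ : MvPowerSeries (Fin 2) k} (h : (X 0 : MvPowerSeries (Fin 2) k) ∣ ψ) :
    (X a : MvPowerSeries (Fin (m + 1)) k) ∣ onPlane a b ψ := by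
  obtain ⟨q, rfl⟩ := h
  refine ⟨onPlane a b q, ?_⟩
  rw [onPlane_eq_substAlgHom, onPlane_eq_substAlgHom, map_mul, coe_substAlgHom, subst_X (hasSubst_base a b)]
  rfl

/-- **(P1) FOR THE CURVE MOVE ALONG `Γ_a = S ∩ E_a`** (memo §6).  Let `(a, b, ψ)` be a graph surface permissible at order `c` for `g`
(`shear_{a,b}(ψ)^* g ∈ (x_j : j ∉ {a,b})^c`) and `E` a set of letters whose off-base members have traces divisible by `u₁` (`Γ_a ⊂ E_l`).  Then the
PARTIAL shear `Φ̂ = shear_{a,b}(ψ̂)`, `ψ̂ = 0` on `E` and `ψ` elsewhere (legal and letter-preserving on `E`), satisfies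
`c ≤ weightedOrder_w (Φ̂^* g)` for the weights `w = 𝟙_{≠ b}` — the centre `Φ̂(V(x_i : i ≠ b)) = Γ_a` is permissible for `g`.  Proof: `Φ̂ = Φ ∘ τ` with
`τ_l = x_l − ψ_l(x_a, x_b)` on the off-base letters of `E`, and `le_weightedOrder_subst_of_inOffPlaneIdeal`. -/
theorem le_weightedOrder_partialShear {a b : Fin (m + 1)} (hab : a ≠ b) {ψ : Fin (m + 1) → MvPowerSeries (Fin 2) k}
    (hψ : ∀ j, ¬ (j = a ∨ j = b) → constantCoeff (ψ j) = 0) (E : Finset (Fin (m + 1)))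
    (hE : ∀ l ∈ E, ¬ (l = a ∨ l = b) → (X 0 : MvPowerSeries (Fin 2) k) ∣ ψ l) {c : ℕ} {g : MvPowerSeries (Fin (m + 1)) k}
    (hperm : InOffPlaneIdeal a b c (subst (shear a b ψ) g)) :
    (c : ℕ∞) ≤ (subst (shear a b (fun j => if j ∈ E then 0 else ψ j)) g).weightedOrder (fun j => if j = b then 0 else 1) := by
  classical
  have hba : b ≠ a := fun h => hab h.symm
  -- the correcting substitution `τ`
  set τ : Fin (m + 1) → MvPowerSeries (Fin (m + 1)) k :=
    fun j => if j ∈ E ∧ ¬ (j = a ∨ j = b) then X j - onPlane a b (ψ j) else X j with hτ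
  have hτ0 : ∀ j, constantCoeff (τ j) = 0 := by
    intro j
    simp only [hτ]
    split_ifs with h
    · rw [map_sub, constantCoeff_X, constantCoeff_onPlane, hψ j h.2, sub_zero]
    · exact constantCoeff_X _
  have hτs : HasSubst τ := hasSubst_of_constantCoeff_zero hτ0
  have hτa : τ a = X a := by simp [hτ]
  have hτb : τ b = X b := by simp [hτ]
  have hτplane : ∀ φ : MvPowerSeries (Fin 2) k, subst τ (onPlane a b φ) = onPlane a b φ := by
    intro φ
    rw [subst_onPlane τ hτs, hτa, hτb, onPlane]
  -- `Φ̂ = Φ ∘ τ` on every letter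
  have hψ' : ∀ j, ¬ (j = a ∨ j = b) → constantCoeff ((fun j => if j ∈ E then 0 else ψ j) j) = 0 := by
    intro j hj
    simp only
    split_ifs
    · exact map_zero _
    · exact hψ j hj
  have hcomp : subst (shear a b (fun j => if j ∈ E then 0 else ψ j)) g = subst τ (subst (shear a b ψ) g) := by
    rw [subst_comp_subst_apply (hasSubst_shear hψ) hτs]
    congr 1
    funext j
    by_cases hj : j = a ∨ j = b
    · rw [shear_of_base hj, shear_of_base hj, subst_X hτs]
      simp only [hτ]
      rw [if_neg (fun h => h.2 hj)]
    · by_cases hjE : j ∈ E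
      · rw [shear_eq_X_of_eq_zero (Or.inr (by simp [hjE])), shear_of_ne hj, subst_add hτs, subst_X hτs, hτplane]
        simp only [hτ]
        rw [if_pos ⟨hjE, hj⟩, sub_add_cancel]
      · rw [shear_of_ne hj, shear_of_ne hj, subst_add hτs, subst_X hτs, hτplane]
        simp [hτ, hjE]
  rw [hcomp]
  refine le_weightedOrder_subst_of_inOffPlaneIdeal hperm _ τ hτs fun j hj => ?_
  have hjb : j ≠ b := fun h => hj (Or.inr h)
  by_cases hjE : j ∈ E
  · -- `τ_j = x_j − ψ_j(x_a, x_b)` with `x_a ∣ ψ_j(x_a, x_b)`: no monomial supported on `{b}`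
    simp only [hτ]
    rw [if_pos ⟨hjE, hj⟩]
    refine one_le_weightedOrder_of_coeff_weight_zero _ fun d hd => ?_
    have hd0 : ∀ i, i ≠ b → d i = 0 := fun i hi => by
      have h := Finsupp.le_weight (fun j => if j = b then 0 else 1) (s := i) (by rw [if_neg hi]; exact one_ne_zero) d
      rw [hd] at h
      exact Nat.le_zero.mp h
    rw [map_sub, coeff_X, if_neg, zero_sub, neg_eq_zero]
    · exact (X_dvd_iff.mp (X_dvd_onPlane_of_X_zero_dvd a b (hE j hjE hj))) d (hd0 a (fun h => hab h))
    · intro h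
      have h1 := hd0 j hjb
      rw [h, Finsupp.single_eq_same] at h1
      exact one_ne_zero h1
  · simp only [hτ]
    rw [if_neg (fun h => hjE h.1)]
    exact one_le_weightedOrder_X _ (by rw [if_neg hjb])

end GraphSurf

end TameFourTupleDrop

end Summit.ResolutionOfSingularities.ResolutionOfSingularities.Theorems

end
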